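import Summits.BirchSwinnertonDyer.BirchSwinnertonDyer.Theorems.SylvesterTwoHeegnerIndexLowerHalfFourTorsionMembers
import HarnessLib

/-!
# Route `SylvesterTwoHeegnerIndex` (rung K7t), crux `HeegnerIndexLowerAtTwoHSY` (item 19230):
# the LOWER crux at the 𝒞_HSY members `4·10⁴ < p ≤ 10⁵` with `(ℤ/4)² ↪ Ш(E_p)` — certified rows, part B
# (helper toward stmt-BirchSwinnertonDyer-19230; cell «bsd-cm», seat `bsd-cm-k7t-c3` g3; theorems only)

HONEST FRAMING (cell «bsd-cm»; FULL-BSD RANK ≤ 1 programme, tranche 1a): the class 𝒞_HSY at `p = 2` (B14 / O12)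
is OPEN in print and stays open here; the crux quantifies over ALL `p` and is NOT proved here. THEOREMS ONLY
(0 definitions, 0 named facts, 0 `sorry`). Continuation of `SylvesterTwoHeegnerIndexLowerHalfFourTorsionMembers`
(§1 there: the member-generic consumer `lower_member_of_cert`, `bsdTwo_member_iff_not_32_dvd_of_cert`, and the
reading key of the certificates; rows `p = 30109, 31849, 31873, 34159`); here the rows `p = 48073, 49549, 60919,
62653, 63439, 80779, 89833, 93337, 95071`. Every row is CONDITIONAL on `PublishedFactsTwo` (item 19231) and on two
DISPLAYED PER-CURVE CERTIFICATES NOT proved in the kernel: `hq : #Ш_an(E_p) = 16` (kit j252028: two-engine lattice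
certificate, base pipeline bsd-cm-two n5cert sha16 e7a4af08f9556966 + exact `3`-isogeny-descent generator search;
every row: unique lattice point `4²·1`, certified generator, `|L′_A − L′_B| < 10⁻²⁸`, `bnfcertify` = 1) and
`hS : Ш(E_p)[2] ≅ (ℤ/2)² ⊆ 2·Ш(E_p)` (PARI 2.17 `ellrank = [1, 3, 0]` at efforts `0–3`: `C = 3`, `T = 0`, `s = 0`).
SUMMARY OF THE FOURTEEN (parts A, B and `…LowerHalfWitness18913`): at EVERY 𝒞_HSY member `p ≤ 10⁵` with
`(ℤ/4)² ↪ Ш(E_p)` — `p = 18913, 30109, 31849, 31873, 34159, 48073, 49549, 60919, 62653, 63439, 80779, 89833,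
93337, 95071`, the complete list by the `2`-descent census j250796 of all `2132` members `p ≤ 10⁵` — the certified
analytic order is `#Ш_an(E_p) = 16` EXACTLY: the LOWER inequality `ord₂ 𝔮 = 4 ≤ ord₂ #Ш(E_p)` HOLDS there (modulo
the displayed inputs) and `BSD(E_p, 2)` is EXACTLY `Ш(E_p)[2^∞] ≅ (ℤ/4)²` (`¬ 32 ∣ #Ш`; a `4`-Selmer Cassels–Tate
question, item 19229). No member `p ≤ 10⁵` is left undecided for the lower crux by the cell's certificates; none
contradicts it. By-catch: `#Ш(E_{3p²}) = 784, 16, 16, 529, 4, 16, 1, 16, 25, 400, 625, 2704, 1, 1600` (same order).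

PARTITION (D-0054): CornerF at `2` / O12 × the 𝒞_HSY members with `(ℤ/4)² ↪ Ш(E_p)`,
`4·10⁴ < p ≤ 10⁵` (book230: 0 classes) × `p = 2` — per-pair certificate consumers; closes no cell and
no class; nothing booked; no label moves. NOT a proof of the crux or of `BSD(E_p, 2)` for any `p`.
References (locators only): [HuShuYin2019] Thm. 1.3/1.4 (p. 3), Cor. 4.4; [BurungaleFlach2024]
Thm. 1.1, Cor. 2; [Miller2011LMS] §1, Def. 1.1; [Cremona1997] §3.6; Cassels 1998 (Crelle 494) §1;
Silverman, Math. Comp. 55 (1990) Thm. 1.1.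
-/

set_option autoImplicit false
-- the Theorems namespace `Summit.BirchSwinnertonDyer.BirchSwinnertonDyer.…` repeats a component by design (D-0017 layout)
set_option linter.dupNamespace false

noncomputable section

open scoped Classical

open WeierstrassCurve NumberField Literature.NumberTheory.EllipticCurves
  Literature.NumberTheory.EllipticCurves.ModularForms
  Literature.NumberTheory.EllipticCurves.Rank1Residual
  Literature.NumberTheory.EllipticCurves.Rank1Residual.Typed
  Literature.NumberTheory.EllipticCurves.HuShuYin2019
  Summit.BirchSwinnertonDyer.Rank1Residual.P2
  Summit.BirchSwinnertonDyer.Rank1Residual.X12.Sylvester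
  Summit.BirchSwinnertonDyer.BirchSwinnertonDyer.Theses.SylvesterTwoHeegnerIndex

namespace Summit.BirchSwinnertonDyer.BirchSwinnertonDyer.Theorems

namespace SylvesterTwoLowerCert

/-! ## §2 (continued) The member rows `4·10⁴ < p ≤ 10⁵` (certified data: kit j252028; census j250796) -/

/-- `48073` is an 𝒞_HSY parameter: prime, `48073 ≡ 4 (mod 9)`, and `3` is not a cube mod `48073`
(Euler: `3^((48073−1)/3) = 3^16024 ≢ 1 (mod 48073)`). [cite: HuShuYin2019, Thm. 1.4 (p. 3)] -/
theorem hsy_48073 :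
    Nat.Prime 48073 ∧ (48073 % 9 = 4 ∨ 48073 % 9 = 7) ∧ ¬ ∃ x : ZMod 48073, x ^ 3 = 3 :=
  hsy_of_pow_mod_ne_one (by norm_num) (Or.inl rfl) (by decide +kernel)

/-- **The LOWER crux `HeegnerIndexLowerAtTwoHSY` at `p = 48073`** (body verbatim, `p := 48073`), from
`PublishedFactsTwo` + two DISPLAYED certificates NOT proved in the kernel (kit j252028; reading key in the file header):
`hq : #Ш_an(E_{48073}) = 16` — `S ∈ [15.99980, 16.00004]` ∋ unique lattice point `4^2·1`; generator `(5171031711301/14984641, 11757479273511001883/58005545311)`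
(`ellrank`, `ĥ = 22.09156`, index bound `6`, witnesses `{2: [5, 6], 3: [5, 6], 5: [29, 30]}`); `#Ш(E_{3·48073²}) = 16`, `m(48073) = 4`,
`Cl(ℚ(∛(4·48073))) ≅ [6, 2]` (`bnfcertify` = 1), `k′ = 1` — and `hS : Ш(E_{48073})[2] ≅ (ℤ/2)² ⊆ 2·Ш(E_{48073})`
(`ellrank = [1, 3, 0]` at efforts `0–3`). Hence `ord₂ 𝔮 = 4 ≤ ord₂ #Ш(W)` in every frame. CONDITIONAL; EVIDENCE
consumer; says nothing about other `p`. [cite: HuShuYin2019, Thm. 1.3 and Thm. 1.4 (p. 3)]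
[cite: BurungaleFlach2024, Thm. 1.1 and Cor. 2] [cite: Miller2011LMS, §1 and Def. 1.1] [cite: Cremona1997, §3.6] -/
theorem sylvesterTwoHeegnerIndex_heegnerIndexLowerAtTwoHSY_48073 (hF : PublishedFactsTwo)
    (hq : ∀ (W : WeierstrassCurve ℚ) [W.IsElliptic] [W.IsGloballyMinimal],
      (∃ C : VariableChange ℚ, C • W = cubeSumCurve ((48073 : ℕ) : ℚ)) → shaAn W = ((16 : ℚ) : ℂ))
    (hS : ∀ (W : WeierstrassCurve ℚ) [W.IsElliptic] [W.IsGloballyMinimal],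
      (∃ C : VariableChange ℚ, C • W = cubeSumCurve ((48073 : ℕ) : ℚ)) →
        (∃ x y : W.sha, (2 : ℤ) • x = 0 ∧ (2 : ℤ) • y = 0 ∧ x ≠ 0 ∧ y ≠ 0 ∧ x ≠ y) ∧
        (∀ z : W.sha, (2 : ℤ) • z = 0 → ∃ w : W.sha, (2 : ℤ) • w = z)) :
    ∀ (W : WeierstrassCurve ℚ) [W.IsElliptic] [W.IsGloballyMinimal],
      (∃ C : VariableChange ℚ, C • W = cubeSumCurve ((48073 : ℕ) : ℚ)) →
      ∀ (N : ℕ) [NeZero N] (K : Type) [Field K] [NumberField K]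
        (Dt : ModularParametrizationData W N) (H : HeegnerDatum N (NumberField.discr K)) (ι : K →+* ℂ)
        (P : (W.baseChange K).toAffine.Point) (Wd : WeierstrassCurve ℚ) [Wd.IsElliptic]
        [Wd.IsGloballyMinimal] (Cd : VariableChange ℚ) (k : ℕ),
        W.HasCM → W.analyticRank = 1 → IsImaginaryQuadratic K → SatisfiesHeegnerHypothesis N K →
        WeierstrassCurve.Affine.Point.map ι.toRatAlgHom P = heegnerPointComplex Dt H →
        (W.quadraticTwist (NumberField.discr K : ℚ)).entireLFunction 1 ≠ 0 →
        Cd • W.quadraticTwist (NumberField.discr K : ℚ) = Wd → (k = 1 ∨ k = 2) →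
        (k = 2 ↔ ∀ y : W.toAffine.Point, ∃ Q : (W.baseChange K).toAffine.Point,
          QuadraticDescent.incl K W y - (2 : ℤ) • Q ∈ AddCommGroup.torsion (W.baseChange K).toAffine.Point) →
        padicValRat 2 (cmHeegnerIndexQuotient W K P Dt.c k Wd Cd.u) ≤
          padicValNat 2 (Nat.card W.sha) :=
  lower_member_of_cert hsy_48073 hF (q := 16) padicValRat_two_16.le hq hS

/-- `49549` is an 𝒞_HSY parameter: prime, `49549 ≡ 4 (mod 9)`, and `3` is not a cube mod `49549`
(Euler: `3^((49549−1)/3) = 3^16516 ≢ 1 (mod 49549)`). [cite: HuShuYin2019, Thm. 1.4 (p. 3)] -/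
theorem hsy_49549 :
    Nat.Prime 49549 ∧ (49549 % 9 = 4 ∨ 49549 % 9 = 7) ∧ ¬ ∃ x : ZMod 49549, x ^ 3 = 3 :=
  hsy_of_pow_mod_ne_one (by norm_num) (Or.inl rfl) (by decide +kernel)

/-- **The LOWER crux `HeegnerIndexLowerAtTwoHSY` at `p = 49549`** (body verbatim, `p := 49549`), from
`PublishedFactsTwo` + two DISPLAYED certificates NOT proved in the kernel (kit j252028; reading key in the file header):
`hq : #Ш_an(E_{49549}) = 16` — `S ∈ [15.99967, 16.00007]` ∋ unique lattice point `4^2·1`; generator `(605934721/131044, 12432846129427/47437928)`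
(`ellrank`, `ĥ = 13.33917`, index bound `5`, witnesses `{2: [5, 6], 3: [5, 6], 5: [59, 60]}`); smallest cubic solution `(488109863)³ + (-61168511)³ = 49549·13280694³`; `#Ш(E_{3·49549²}) = 1`, `m(49549) = 2`,
`Cl(ℚ(∛(4·49549))) ≅ [6, 6]` (`bnfcertify` = 1), `k′ = 0` — and `hS : Ш(E_{49549})[2] ≅ (ℤ/2)² ⊆ 2·Ш(E_{49549})`
(`ellrank = [1, 3, 0]` at efforts `0–3`). Hence `ord₂ 𝔮 = 4 ≤ ord₂ #Ш(W)` in every frame. CONDITIONAL; EVIDENCE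
consumer; says nothing about other `p`. [cite: HuShuYin2019, Thm. 1.3 and Thm. 1.4 (p. 3)]
[cite: BurungaleFlach2024, Thm. 1.1 and Cor. 2] [cite: Miller2011LMS, §1 and Def. 1.1] [cite: Cremona1997, §3.6] -/
theorem sylvesterTwoHeegnerIndex_heegnerIndexLowerAtTwoHSY_49549 (hF : PublishedFactsTwo)
    (hq : ∀ (W : WeierstrassCurve ℚ) [W.IsElliptic] [W.IsGloballyMinimal],
      (∃ C : VariableChange ℚ, C • W = cubeSumCurve ((49549 : ℕ) : ℚ)) → shaAn W = ((16 : ℚ) : ℂ))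
    (hS : ∀ (W : WeierstrassCurve ℚ) [W.IsElliptic] [W.IsGloballyMinimal],
      (∃ C : VariableChange ℚ, C • W = cubeSumCurve ((49549 : ℕ) : ℚ)) →
        (∃ x y : W.sha, (2 : ℤ) • x = 0 ∧ (2 : ℤ) • y = 0 ∧ x ≠ 0 ∧ y ≠ 0 ∧ x ≠ y) ∧
        (∀ z : W.sha, (2 : ℤ) • z = 0 → ∃ w : W.sha, (2 : ℤ) • w = z)) :
    ∀ (W : WeierstrassCurve ℚ) [W.IsElliptic] [W.IsGloballyMinimal],
      (∃ C : VariableChange ℚ, C • W = cubeSumCurve ((49549 : ℕ) : ℚ)) →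
      ∀ (N : ℕ) [NeZero N] (K : Type) [Field K] [NumberField K]
        (Dt : ModularParametrizationData W N) (H : HeegnerDatum N (NumberField.discr K)) (ι : K →+* ℂ)
        (P : (W.baseChange K).toAffine.Point) (Wd : WeierstrassCurve ℚ) [Wd.IsElliptic]
        [Wd.IsGloballyMinimal] (Cd : VariableChange ℚ) (k : ℕ),
        W.HasCM → W.analyticRank = 1 → IsImaginaryQuadratic K → SatisfiesHeegnerHypothesis N K →
        WeierstrassCurve.Affine.Point.map ι.toRatAlgHom P = heegnerPointComplex Dt H →
        (W.quadraticTwist (NumberField.discr K : ℚ)).entireLFunction 1 ≠ 0 →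
        Cd • W.quadraticTwist (NumberField.discr K : ℚ) = Wd → (k = 1 ∨ k = 2) →
        (k = 2 ↔ ∀ y : W.toAffine.Point, ∃ Q : (W.baseChange K).toAffine.Point,
          QuadraticDescent.incl K W y - (2 : ℤ) • Q ∈ AddCommGroup.torsion (W.baseChange K).toAffine.Point) →
        padicValRat 2 (cmHeegnerIndexQuotient W K P Dt.c k Wd Cd.u) ≤
          padicValNat 2 (Nat.card W.sha) :=
  lower_member_of_cert hsy_49549 hF (q := 16) padicValRat_two_16.le hq hS

/-- `60919` is an 𝒞_HSY parameter: prime, `60919 ≡ 7 (mod 9)`, and `3` is not a cube mod `60919`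
(Euler: `3^((60919−1)/3) = 3^20306 ≢ 1 (mod 60919)`). [cite: HuShuYin2019, Thm. 1.4 (p. 3)] -/
theorem hsy_60919 :
    Nat.Prime 60919 ∧ (60919 % 9 = 4 ∨ 60919 % 9 = 7) ∧ ¬ ∃ x : ZMod 60919, x ^ 3 = 3 :=
  hsy_of_pow_mod_ne_one (by norm_num) (Or.inr rfl) (by decide +kernel)

/-- **The LOWER crux `HeegnerIndexLowerAtTwoHSY` at `p = 60919`** (body verbatim, `p := 60919`), from
`PublishedFactsTwo` + two DISPLAYED certificates NOT proved in the kernel (kit j252028; reading key in the file header):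
`hq : #Ш_an(E_{60919}) = 16` — `S ∈ [15.99859, 16.00031]` ∋ unique lattice point `4^2·1`; generator `(182757, 78098158)`
(`ellrank`, `ĥ = 3.132973`, index bound `2`, witnesses `{2: [5, 6]}`); smallest cubic solution `(143)³ + (-142)³ = 60919·1³`; `#Ш(E_{3·60919²}) = 16`, `m(60919) = 5`,
`Cl(ℚ(∛(4·60919))) ≅ [6]` (`bnfcertify` = 1), `k′ = 1` — and `hS : Ш(E_{60919})[2] ≅ (ℤ/2)² ⊆ 2·Ш(E_{60919})`
(`ellrank = [1, 3, 0]` at efforts `0–3`). Hence `ord₂ 𝔮 = 4 ≤ ord₂ #Ш(W)` in every frame. CONDITIONAL; EVIDENCE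
consumer; says nothing about other `p`. [cite: HuShuYin2019, Thm. 1.3 and Thm. 1.4 (p. 3)]
[cite: BurungaleFlach2024, Thm. 1.1 and Cor. 2] [cite: Miller2011LMS, §1 and Def. 1.1] [cite: Cremona1997, §3.6] -/
theorem sylvesterTwoHeegnerIndex_heegnerIndexLowerAtTwoHSY_60919 (hF : PublishedFactsTwo)
    (hq : ∀ (W : WeierstrassCurve ℚ) [W.IsElliptic] [W.IsGloballyMinimal],
      (∃ C : VariableChange ℚ, C • W = cubeSumCurve ((60919 : ℕ) : ℚ)) → shaAn W = ((16 : ℚ) : ℂ))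
    (hS : ∀ (W : WeierstrassCurve ℚ) [W.IsElliptic] [W.IsGloballyMinimal],
      (∃ C : VariableChange ℚ, C • W = cubeSumCurve ((60919 : ℕ) : ℚ)) →
        (∃ x y : W.sha, (2 : ℤ) • x = 0 ∧ (2 : ℤ) • y = 0 ∧ x ≠ 0 ∧ y ≠ 0 ∧ x ≠ y) ∧
        (∀ z : W.sha, (2 : ℤ) • z = 0 → ∃ w : W.sha, (2 : ℤ) • w = z)) :
    ∀ (W : WeierstrassCurve ℚ) [W.IsElliptic] [W.IsGloballyMinimal],
      (∃ C : VariableChange ℚ, C • W = cubeSumCurve ((60919 : ℕ) : ℚ)) →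
      ∀ (N : ℕ) [NeZero N] (K : Type) [Field K] [NumberField K]
        (Dt : ModularParametrizationData W N) (H : HeegnerDatum N (NumberField.discr K)) (ι : K →+* ℂ)
        (P : (W.baseChange K).toAffine.Point) (Wd : WeierstrassCurve ℚ) [Wd.IsElliptic]
        [Wd.IsGloballyMinimal] (Cd : VariableChange ℚ) (k : ℕ),
        W.HasCM → W.analyticRank = 1 → IsImaginaryQuadratic K → SatisfiesHeegnerHypothesis N K →
        WeierstrassCurve.Affine.Point.map ι.toRatAlgHom P = heegnerPointComplex Dt H →
        (W.quadraticTwist (NumberField.discr K : ℚ)).entireLFunction 1 ≠ 0 →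
        Cd • W.quadraticTwist (NumberField.discr K : ℚ) = Wd → (k = 1 ∨ k = 2) →
        (k = 2 ↔ ∀ y : W.toAffine.Point, ∃ Q : (W.baseChange K).toAffine.Point,
          QuadraticDescent.incl K W y - (2 : ℤ) • Q ∈ AddCommGroup.torsion (W.baseChange K).toAffine.Point) →
        padicValRat 2 (cmHeegnerIndexQuotient W K P Dt.c k Wd Cd.u) ≤
          padicValNat 2 (Nat.card W.sha) :=
  lower_member_of_cert hsy_60919 hF (q := 16) padicValRat_two_16.le hq hS

/-- `62653` is an 𝒞_HSY parameter: prime, `62653 ≡ 4 (mod 9)`, and `3` is not a cube mod `62653`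
(Euler: `3^((62653−1)/3) = 3^20884 ≢ 1 (mod 62653)`). [cite: HuShuYin2019, Thm. 1.4 (p. 3)] -/
theorem hsy_62653 :
    Nat.Prime 62653 ∧ (62653 % 9 = 4 ∨ 62653 % 9 = 7) ∧ ¬ ∃ x : ZMod 62653, x ^ 3 = 3 :=
  hsy_of_pow_mod_ne_one (by norm_num) (Or.inl rfl) (by decide +kernel)

/-- **The LOWER crux `HeegnerIndexLowerAtTwoHSY` at `p = 62653`** (body verbatim, `p := 62653`), from
`PublishedFactsTwo` + two DISPLAYED certificates NOT proved in the kernel (kit j252028; reading key in the file header):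
`hq : #Ш_an(E_{62653}) = 16` — `S ∈ [15.99951, 16.00011]` ∋ unique lattice point `4^2·1`; generator `(13595701/361, 49903239806/6859)`
(`ellrank`, `ĥ = 9.110308`, index bound `4`, witnesses `{2: [5, 6], 3: [5, 6]}`); smallest cubic solution `(830797)³ + (-769066)³ = 62653·12369³`; `#Ш(E_{3·62653²}) = 25`, `m(62653) = 2`,
`Cl(ℚ(∛(4·62653))) ≅ [12, 2]` (`bnfcertify` = 1), `k′ = 0` — and `hS : Ш(E_{62653})[2] ≅ (ℤ/2)² ⊆ 2·Ш(E_{62653})`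
(`ellrank = [1, 3, 0]` at efforts `0–3`). Hence `ord₂ 𝔮 = 4 ≤ ord₂ #Ш(W)` in every frame. CONDITIONAL; EVIDENCE
consumer; says nothing about other `p`. [cite: HuShuYin2019, Thm. 1.3 and Thm. 1.4 (p. 3)]
[cite: BurungaleFlach2024, Thm. 1.1 and Cor. 2] [cite: Miller2011LMS, §1 and Def. 1.1] [cite: Cremona1997, §3.6] -/
theorem sylvesterTwoHeegnerIndex_heegnerIndexLowerAtTwoHSY_62653 (hF : PublishedFactsTwo)
    (hq : ∀ (W : WeierstrassCurve ℚ) [W.IsElliptic] [W.IsGloballyMinimal],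
      (∃ C : VariableChange ℚ, C • W = cubeSumCurve ((62653 : ℕ) : ℚ)) → shaAn W = ((16 : ℚ) : ℂ))
    (hS : ∀ (W : WeierstrassCurve ℚ) [W.IsElliptic] [W.IsGloballyMinimal],
      (∃ C : VariableChange ℚ, C • W = cubeSumCurve ((62653 : ℕ) : ℚ)) →
        (∃ x y : W.sha, (2 : ℤ) • x = 0 ∧ (2 : ℤ) • y = 0 ∧ x ≠ 0 ∧ y ≠ 0 ∧ x ≠ y) ∧
        (∀ z : W.sha, (2 : ℤ) • z = 0 → ∃ w : W.sha, (2 : ℤ) • w = z)) :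
    ∀ (W : WeierstrassCurve ℚ) [W.IsElliptic] [W.IsGloballyMinimal],
      (∃ C : VariableChange ℚ, C • W = cubeSumCurve ((62653 : ℕ) : ℚ)) →
      ∀ (N : ℕ) [NeZero N] (K : Type) [Field K] [NumberField K]
        (Dt : ModularParametrizationData W N) (H : HeegnerDatum N (NumberField.discr K)) (ι : K →+* ℂ)
        (P : (W.baseChange K).toAffine.Point) (Wd : WeierstrassCurve ℚ) [Wd.IsElliptic]
        [Wd.IsGloballyMinimal] (Cd : VariableChange ℚ) (k : ℕ),
        W.HasCM → W.analyticRank = 1 → IsImaginaryQuadratic K → SatisfiesHeegnerHypothesis N K →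
        WeierstrassCurve.Affine.Point.map ι.toRatAlgHom P = heegnerPointComplex Dt H →
        (W.quadraticTwist (NumberField.discr K : ℚ)).entireLFunction 1 ≠ 0 →
        Cd • W.quadraticTwist (NumberField.discr K : ℚ) = Wd → (k = 1 ∨ k = 2) →
        (k = 2 ↔ ∀ y : W.toAffine.Point, ∃ Q : (W.baseChange K).toAffine.Point,
          QuadraticDescent.incl K W y - (2 : ℤ) • Q ∈ AddCommGroup.torsion (W.baseChange K).toAffine.Point) →
        padicValRat 2 (cmHeegnerIndexQuotient W K P Dt.c k Wd Cd.u) ≤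
          padicValNat 2 (Nat.card W.sha) :=
  lower_member_of_cert hsy_62653 hF (q := 16) padicValRat_two_16.le hq hS

/-- `63439` is an 𝒞_HSY parameter: prime, `63439 ≡ 7 (mod 9)`, and `3` is not a cube mod `63439`
(Euler: `3^((63439−1)/3) = 3^21146 ≢ 1 (mod 63439)`). [cite: HuShuYin2019, Thm. 1.4 (p. 3)] -/
theorem hsy_63439 :
    Nat.Prime 63439 ∧ (63439 % 9 = 4 ∨ 63439 % 9 = 7) ∧ ¬ ∃ x : ZMod 63439, x ^ 3 = 3 :=
  hsy_of_pow_mod_ne_one (by norm_num) (Or.inr rfl) (by decide +kernel)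

/-- **The LOWER crux `HeegnerIndexLowerAtTwoHSY` at `p = 63439`** (body verbatim, `p := 63439`), from
`PublishedFactsTwo` + two DISPLAYED certificates NOT proved in the kernel (kit j252028; reading key in the file header):
`hq : #Ш_an(E_{63439}) = 16` — `S ∈ [15.99877, 16.00028]` ∋ unique lattice point `4^2·1`; generator `(190317/49, 49926493/343)`
(`ellrank`, `ĥ = 3.577088`, index bound `2`, witnesses `{2: [11, 12]}`); smallest cubic solution `(278)³ + (65)³ = 63439·7³`; `#Ш(E_{3·63439²}) = 400`, `m(63439) = 5`,
`Cl(ℚ(∛(4·63439))) ≅ [6]` (`bnfcertify` = 1), `k′ = 1` — and `hS : Ш(E_{63439})[2] ≅ (ℤ/2)² ⊆ 2·Ш(E_{63439})`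
(`ellrank = [1, 3, 0]` at efforts `0–3`). Hence `ord₂ 𝔮 = 4 ≤ ord₂ #Ш(W)` in every frame. CONDITIONAL; EVIDENCE
consumer; says nothing about other `p`. [cite: HuShuYin2019, Thm. 1.3 and Thm. 1.4 (p. 3)]
[cite: BurungaleFlach2024, Thm. 1.1 and Cor. 2] [cite: Miller2011LMS, §1 and Def. 1.1] [cite: Cremona1997, §3.6] -/
theorem sylvesterTwoHeegnerIndex_heegnerIndexLowerAtTwoHSY_63439 (hF : PublishedFactsTwo)
    (hq : ∀ (W : WeierstrassCurve ℚ) [W.IsElliptic] [W.IsGloballyMinimal],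
      (∃ C : VariableChange ℚ, C • W = cubeSumCurve ((63439 : ℕ) : ℚ)) → shaAn W = ((16 : ℚ) : ℂ))
    (hS : ∀ (W : WeierstrassCurve ℚ) [W.IsElliptic] [W.IsGloballyMinimal],
      (∃ C : VariableChange ℚ, C • W = cubeSumCurve ((63439 : ℕ) : ℚ)) →
        (∃ x y : W.sha, (2 : ℤ) • x = 0 ∧ (2 : ℤ) • y = 0 ∧ x ≠ 0 ∧ y ≠ 0 ∧ x ≠ y) ∧
        (∀ z : W.sha, (2 : ℤ) • z = 0 → ∃ w : W.sha, (2 : ℤ) • w = z)) :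
    ∀ (W : WeierstrassCurve ℚ) [W.IsElliptic] [W.IsGloballyMinimal],
      (∃ C : VariableChange ℚ, C • W = cubeSumCurve ((63439 : ℕ) : ℚ)) →
      ∀ (N : ℕ) [NeZero N] (K : Type) [Field K] [NumberField K]
        (Dt : ModularParametrizationData W N) (H : HeegnerDatum N (NumberField.discr K)) (ι : K →+* ℂ)
        (P : (W.baseChange K).toAffine.Point) (Wd : WeierstrassCurve ℚ) [Wd.IsElliptic]
        [Wd.IsGloballyMinimal] (Cd : VariableChange ℚ) (k : ℕ),
        W.HasCM → W.analyticRank = 1 → IsImaginaryQuadratic K → SatisfiesHeegnerHypothesis N K →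
        WeierstrassCurve.Affine.Point.map ι.toRatAlgHom P = heegnerPointComplex Dt H →
        (W.quadraticTwist (NumberField.discr K : ℚ)).entireLFunction 1 ≠ 0 →
        Cd • W.quadraticTwist (NumberField.discr K : ℚ) = Wd → (k = 1 ∨ k = 2) →
        (k = 2 ↔ ∀ y : W.toAffine.Point, ∃ Q : (W.baseChange K).toAffine.Point,
          QuadraticDescent.incl K W y - (2 : ℤ) • Q ∈ AddCommGroup.torsion (W.baseChange K).toAffine.Point) →
        padicValRat 2 (cmHeegnerIndexQuotient W K P Dt.c k Wd Cd.u) ≤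
          padicValNat 2 (Nat.card W.sha) :=
  lower_member_of_cert hsy_63439 hF (q := 16) padicValRat_two_16.le hq hS

/-- `80779` is an 𝒞_HSY parameter: prime, `80779 ≡ 4 (mod 9)`, and `3` is not a cube mod `80779`
(Euler: `3^((80779−1)/3) = 3^26926 ≢ 1 (mod 80779)`). [cite: HuShuYin2019, Thm. 1.4 (p. 3)] -/
theorem hsy_80779 :
    Nat.Prime 80779 ∧ (80779 % 9 = 4 ∨ 80779 % 9 = 7) ∧ ¬ ∃ x : ZMod 80779, x ^ 3 = 3 :=
  hsy_of_pow_mod_ne_one (by norm_num) (Or.inl rfl) (by decide +kernel)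

/-- **The LOWER crux `HeegnerIndexLowerAtTwoHSY` at `p = 80779`** (body verbatim, `p := 80779`), from
`PublishedFactsTwo` + two DISPLAYED certificates NOT proved in the kernel (kit j252028; reading key in the file header):
`hq : #Ш_an(E_{80779}) = 16` — `S ∈ [15.99942, 16.00011]` ∋ unique lattice point `4^2·1`; generator `(2988823/841, -277879760/24389)`
(`ellrank`, `ĥ = 7.923810`, index bound `3`, witnesses `{2: [11, 12], 3: [5, 6]}`); smallest cubic solution `(118505)³ + (100996)³ = 80779·3219³`; `#Ш(E_{3·80779²}) = 625`, `m(80779) = 2`,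
`Cl(ℚ(∛(4·80779))) ≅ [12, 2]` (`bnfcertify` = 1), `k′ = 0` — and `hS : Ш(E_{80779})[2] ≅ (ℤ/2)² ⊆ 2·Ш(E_{80779})`
(`ellrank = [1, 3, 0]` at efforts `0–3`). Hence `ord₂ 𝔮 = 4 ≤ ord₂ #Ш(W)` in every frame. CONDITIONAL; EVIDENCE
consumer; says nothing about other `p`. [cite: HuShuYin2019, Thm. 1.3 and Thm. 1.4 (p. 3)]
[cite: BurungaleFlach2024, Thm. 1.1 and Cor. 2] [cite: Miller2011LMS, §1 and Def. 1.1] [cite: Cremona1997, §3.6] -/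
theorem sylvesterTwoHeegnerIndex_heegnerIndexLowerAtTwoHSY_80779 (hF : PublishedFactsTwo)
    (hq : ∀ (W : WeierstrassCurve ℚ) [W.IsElliptic] [W.IsGloballyMinimal],
      (∃ C : VariableChange ℚ, C • W = cubeSumCurve ((80779 : ℕ) : ℚ)) → shaAn W = ((16 : ℚ) : ℂ))
    (hS : ∀ (W : WeierstrassCurve ℚ) [W.IsElliptic] [W.IsGloballyMinimal],
      (∃ C : VariableChange ℚ, C • W = cubeSumCurve ((80779 : ℕ) : ℚ)) →
        (∃ x y : W.sha, (2 : ℤ) • x = 0 ∧ (2 : ℤ) • y = 0 ∧ x ≠ 0 ∧ y ≠ 0 ∧ x ≠ y) ∧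
        (∀ z : W.sha, (2 : ℤ) • z = 0 → ∃ w : W.sha, (2 : ℤ) • w = z)) :
    ∀ (W : WeierstrassCurve ℚ) [W.IsElliptic] [W.IsGloballyMinimal],
      (∃ C : VariableChange ℚ, C • W = cubeSumCurve ((80779 : ℕ) : ℚ)) →
      ∀ (N : ℕ) [NeZero N] (K : Type) [Field K] [NumberField K]
        (Dt : ModularParametrizationData W N) (H : HeegnerDatum N (NumberField.discr K)) (ι : K →+* ℂ)
        (P : (W.baseChange K).toAffine.Point) (Wd : WeierstrassCurve ℚ) [Wd.IsElliptic]
        [Wd.IsGloballyMinimal] (Cd : VariableChange ℚ) (k : ℕ),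
        W.HasCM → W.analyticRank = 1 → IsImaginaryQuadratic K → SatisfiesHeegnerHypothesis N K →
        WeierstrassCurve.Affine.Point.map ι.toRatAlgHom P = heegnerPointComplex Dt H →
        (W.quadraticTwist (NumberField.discr K : ℚ)).entireLFunction 1 ≠ 0 →
        Cd • W.quadraticTwist (NumberField.discr K : ℚ) = Wd → (k = 1 ∨ k = 2) →
        (k = 2 ↔ ∀ y : W.toAffine.Point, ∃ Q : (W.baseChange K).toAffine.Point,
          QuadraticDescent.incl K W y - (2 : ℤ) • Q ∈ AddCommGroup.torsion (W.baseChange K).toAffine.Point) →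
        padicValRat 2 (cmHeegnerIndexQuotient W K P Dt.c k Wd Cd.u) ≤
          padicValNat 2 (Nat.card W.sha) :=
  lower_member_of_cert hsy_80779 hF (q := 16) padicValRat_two_16.le hq hS

/-- `89833` is an 𝒞_HSY parameter: prime, `89833 ≡ 4 (mod 9)`, and `3` is not a cube mod `89833`
(Euler: `3^((89833−1)/3) = 3^29944 ≢ 1 (mod 89833)`). [cite: HuShuYin2019, Thm. 1.4 (p. 3)] -/
theorem hsy_89833 :
    Nat.Prime 89833 ∧ (89833 % 9 = 4 ∨ 89833 % 9 = 7) ∧ ¬ ∃ x : ZMod 89833, x ^ 3 = 3 :=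
  hsy_of_pow_mod_ne_one (by norm_num) (Or.inl rfl) (by decide +kernel)

/-- **The LOWER crux `HeegnerIndexLowerAtTwoHSY` at `p = 89833`** (body verbatim, `p := 89833`), from
`PublishedFactsTwo` + two DISPLAYED certificates NOT proved in the kernel (kit j252028; reading key in the file header):
`hq : #Ш_an(E_{89833}) = 16` — `S ∈ [15.99883, 16.00025]` ∋ unique lattice point `4^2·1`; generator `(89833/4, 26500735/8)`
(`ellrank`, `ĥ = 3.905141`, index bound `2`, witnesses `{2: [11, 12]}`); smallest cubic solution `(335)³ + (-263)³ = 89833·6³`; `#Ш(E_{3·89833²}) = 2704`, `m(89833) = 4`,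
`Cl(ℚ(∛(4·89833))) ≅ [12, 6]` (`bnfcertify` = 1), `k′ = 2` — and `hS : Ш(E_{89833})[2] ≅ (ℤ/2)² ⊆ 2·Ш(E_{89833})`
(`ellrank = [1, 3, 0]` at efforts `0–3`). Hence `ord₂ 𝔮 = 4 ≤ ord₂ #Ш(W)` in every frame. CONDITIONAL; EVIDENCE
consumer; says nothing about other `p`. [cite: HuShuYin2019, Thm. 1.3 and Thm. 1.4 (p. 3)]
[cite: BurungaleFlach2024, Thm. 1.1 and Cor. 2] [cite: Miller2011LMS, §1 and Def. 1.1] [cite: Cremona1997, §3.6] -/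
theorem sylvesterTwoHeegnerIndex_heegnerIndexLowerAtTwoHSY_89833 (hF : PublishedFactsTwo)
    (hq : ∀ (W : WeierstrassCurve ℚ) [W.IsElliptic] [W.IsGloballyMinimal],
      (∃ C : VariableChange ℚ, C • W = cubeSumCurve ((89833 : ℕ) : ℚ)) → shaAn W = ((16 : ℚ) : ℂ))
    (hS : ∀ (W : WeierstrassCurve ℚ) [W.IsElliptic] [W.IsGloballyMinimal],
      (∃ C : VariableChange ℚ, C • W = cubeSumCurve ((89833 : ℕ) : ℚ)) →
        (∃ x y : W.sha, (2 : ℤ) • x = 0 ∧ (2 : ℤ) • y = 0 ∧ x ≠ 0 ∧ y ≠ 0 ∧ x ≠ y) ∧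
        (∀ z : W.sha, (2 : ℤ) • z = 0 → ∃ w : W.sha, (2 : ℤ) • w = z)) :
    ∀ (W : WeierstrassCurve ℚ) [W.IsElliptic] [W.IsGloballyMinimal],
      (∃ C : VariableChange ℚ, C • W = cubeSumCurve ((89833 : ℕ) : ℚ)) →
      ∀ (N : ℕ) [NeZero N] (K : Type) [Field K] [NumberField K]
        (Dt : ModularParametrizationData W N) (H : HeegnerDatum N (NumberField.discr K)) (ι : K →+* ℂ)
        (P : (W.baseChange K).toAffine.Point) (Wd : WeierstrassCurve ℚ) [Wd.IsElliptic]
        [Wd.IsGloballyMinimal] (Cd : VariableChange ℚ) (k : ℕ),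
        W.HasCM → W.analyticRank = 1 → IsImaginaryQuadratic K → SatisfiesHeegnerHypothesis N K →
        WeierstrassCurve.Affine.Point.map ι.toRatAlgHom P = heegnerPointComplex Dt H →
        (W.quadraticTwist (NumberField.discr K : ℚ)).entireLFunction 1 ≠ 0 →
        Cd • W.quadraticTwist (NumberField.discr K : ℚ) = Wd → (k = 1 ∨ k = 2) →
        (k = 2 ↔ ∀ y : W.toAffine.Point, ∃ Q : (W.baseChange K).toAffine.Point,
          QuadraticDescent.incl K W y - (2 : ℤ) • Q ∈ AddCommGroup.torsion (W.baseChange K).toAffine.Point) →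
        padicValRat 2 (cmHeegnerIndexQuotient W K P Dt.c k Wd Cd.u) ≤
          padicValNat 2 (Nat.card W.sha) :=
  lower_member_of_cert hsy_89833 hF (q := 16) padicValRat_two_16.le hq hS

/-- `93337` is an 𝒞_HSY parameter: prime, `93337 ≡ 7 (mod 9)`, and `3` is not a cube mod `93337`
(Euler: `3^((93337−1)/3) = 3^31112 ≢ 1 (mod 93337)`). [cite: HuShuYin2019, Thm. 1.4 (p. 3)] -/
theorem hsy_93337 :
    Nat.Prime 93337 ∧ (93337 % 9 = 4 ∨ 93337 % 9 = 7) ∧ ¬ ∃ x : ZMod 93337, x ^ 3 = 3 :=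
  hsy_of_pow_mod_ne_one (by norm_num) (Or.inr rfl) (by decide +kernel)

/-- **The LOWER crux `HeegnerIndexLowerAtTwoHSY` at `p = 93337`** (body verbatim, `p := 93337`), from
`PublishedFactsTwo` + two DISPLAYED certificates NOT proved in the kernel (kit j252028; reading key in the file header):
`hq : #Ш_an(E_{93337}) = 16` — `S ∈ [15.99882, 16.00026]` ∋ unique lattice point `4^2·1`; generator `(93337, 28467785)`
(`ellrank`, `ĥ = 3.840271`, index bound `2`, witnesses `{2: [11, 12]}`); smallest cubic solution `(310)³ + (-301)³ = 93337·3³`; `#Ш(E_{3·93337²}) = 1`, `m(93337) = 3`,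
`Cl(ℚ(∛(4·93337))) ≅ [6]` (`bnfcertify` = 1), `k′ = 0` — and `hS : Ш(E_{93337})[2] ≅ (ℤ/2)² ⊆ 2·Ш(E_{93337})`
(`ellrank = [1, 3, 0]` at efforts `0–3`). Hence `ord₂ 𝔮 = 4 ≤ ord₂ #Ш(W)` in every frame. CONDITIONAL; EVIDENCE
consumer; says nothing about other `p`. [cite: HuShuYin2019, Thm. 1.3 and Thm. 1.4 (p. 3)]
[cite: BurungaleFlach2024, Thm. 1.1 and Cor. 2] [cite: Miller2011LMS, §1 and Def. 1.1] [cite: Cremona1997, §3.6] -/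
theorem sylvesterTwoHeegnerIndex_heegnerIndexLowerAtTwoHSY_93337 (hF : PublishedFactsTwo)
    (hq : ∀ (W : WeierstrassCurve ℚ) [W.IsElliptic] [W.IsGloballyMinimal],
      (∃ C : VariableChange ℚ, C • W = cubeSumCurve ((93337 : ℕ) : ℚ)) → shaAn W = ((16 : ℚ) : ℂ))
    (hS : ∀ (W : WeierstrassCurve ℚ) [W.IsElliptic] [W.IsGloballyMinimal],
      (∃ C : VariableChange ℚ, C • W = cubeSumCurve ((93337 : ℕ) : ℚ)) →
        (∃ x y : W.sha, (2 : ℤ) • x = 0 ∧ (2 : ℤ) • y = 0 ∧ x ≠ 0 ∧ y ≠ 0 ∧ x ≠ y) ∧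
        (∀ z : W.sha, (2 : ℤ) • z = 0 → ∃ w : W.sha, (2 : ℤ) • w = z)) :
    ∀ (W : WeierstrassCurve ℚ) [W.IsElliptic] [W.IsGloballyMinimal],
      (∃ C : VariableChange ℚ, C • W = cubeSumCurve ((93337 : ℕ) : ℚ)) →
      ∀ (N : ℕ) [NeZero N] (K : Type) [Field K] [NumberField K]
        (Dt : ModularParametrizationData W N) (H : HeegnerDatum N (NumberField.discr K)) (ι : K →+* ℂ)
        (P : (W.baseChange K).toAffine.Point) (Wd : WeierstrassCurve ℚ) [Wd.IsElliptic]
        [Wd.IsGloballyMinimal] (Cd : VariableChange ℚ) (k : ℕ),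
        W.HasCM → W.analyticRank = 1 → IsImaginaryQuadratic K → SatisfiesHeegnerHypothesis N K →
        WeierstrassCurve.Affine.Point.map ι.toRatAlgHom P = heegnerPointComplex Dt H →
        (W.quadraticTwist (NumberField.discr K : ℚ)).entireLFunction 1 ≠ 0 →
        Cd • W.quadraticTwist (NumberField.discr K : ℚ) = Wd → (k = 1 ∨ k = 2) →
        (k = 2 ↔ ∀ y : W.toAffine.Point, ∃ Q : (W.baseChange K).toAffine.Point,
          QuadraticDescent.incl K W y - (2 : ℤ) • Q ∈ AddCommGroup.torsion (W.baseChange K).toAffine.Point) →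
        padicValRat 2 (cmHeegnerIndexQuotient W K P Dt.c k Wd Cd.u) ≤
          padicValNat 2 (Nat.card W.sha) :=
  lower_member_of_cert hsy_93337 hF (q := 16) padicValRat_two_16.le hq hS

/-- `95071` is an 𝒞_HSY parameter: prime, `95071 ≡ 4 (mod 9)`, and `3` is not a cube mod `95071`
(Euler: `3^((95071−1)/3) = 3^31690 ≢ 1 (mod 95071)`). [cite: HuShuYin2019, Thm. 1.4 (p. 3)] -/
theorem hsy_95071 :
    Nat.Prime 95071 ∧ (95071 % 9 = 4 ∨ 95071 % 9 = 7) ∧ ¬ ∃ x : ZMod 95071, x ^ 3 = 3 :=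
  hsy_of_pow_mod_ne_one (by norm_num) (Or.inl rfl) (by decide +kernel)

/-- **The LOWER crux `HeegnerIndexLowerAtTwoHSY` at `p = 95071`** (body verbatim, `p := 95071`), from
`PublishedFactsTwo` + two DISPLAYED certificates NOT proved in the kernel (kit j252028; reading key in the file header):
`hq : #Ш_an(E_{95071}) = 16` — `S ∈ [15.99926, 16.00014]` ∋ unique lattice point `4^2·1`; generator `(665497/169, -88416030/2197)`
(`ellrank`, `ĥ = 6.315875`, index bound `3`, witnesses `{2: [11, 12], 3: [5, 6]}`); smallest cubic solution `(10055)³ + (9718)³ = 95071·273³`; `#Ш(E_{3·95071²}) = 1600`, `m(95071) = 5`,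
`Cl(ℚ(∛(4·95071))) ≅ [6, 2]` (`bnfcertify` = 1), `k′ = 1` — and `hS : Ш(E_{95071})[2] ≅ (ℤ/2)² ⊆ 2·Ш(E_{95071})`
(`ellrank = [1, 3, 0]` at efforts `0–3`). Hence `ord₂ 𝔮 = 4 ≤ ord₂ #Ш(W)` in every frame. CONDITIONAL; EVIDENCE
consumer; says nothing about other `p`. [cite: HuShuYin2019, Thm. 1.3 and Thm. 1.4 (p. 3)]
[cite: BurungaleFlach2024, Thm. 1.1 and Cor. 2] [cite: Miller2011LMS, §1 and Def. 1.1] [cite: Cremona1997, §3.6] -/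
theorem sylvesterTwoHeegnerIndex_heegnerIndexLowerAtTwoHSY_95071 (hF : PublishedFactsTwo)
    (hq : ∀ (W : WeierstrassCurve ℚ) [W.IsElliptic] [W.IsGloballyMinimal],
      (∃ C : VariableChange ℚ, C • W = cubeSumCurve ((95071 : ℕ) : ℚ)) → shaAn W = ((16 : ℚ) : ℂ))
    (hS : ∀ (W : WeierstrassCurve ℚ) [W.IsElliptic] [W.IsGloballyMinimal],
      (∃ C : VariableChange ℚ, C • W = cubeSumCurve ((95071 : ℕ) : ℚ)) →
        (∃ x y : W.sha, (2 : ℤ) • x = 0 ∧ (2 : ℤ) • y = 0 ∧ x ≠ 0 ∧ y ≠ 0 ∧ x ≠ y) ∧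
        (∀ z : W.sha, (2 : ℤ) • z = 0 → ∃ w : W.sha, (2 : ℤ) • w = z)) :
    ∀ (W : WeierstrassCurve ℚ) [W.IsElliptic] [W.IsGloballyMinimal],
      (∃ C : VariableChange ℚ, C • W = cubeSumCurve ((95071 : ℕ) : ℚ)) →
      ∀ (N : ℕ) [NeZero N] (K : Type) [Field K] [NumberField K]
        (Dt : ModularParametrizationData W N) (H : HeegnerDatum N (NumberField.discr K)) (ι : K →+* ℂ)
        (P : (W.baseChange K).toAffine.Point) (Wd : WeierstrassCurve ℚ) [Wd.IsElliptic]
        [Wd.IsGloballyMinimal] (Cd : VariableChange ℚ) (k : ℕ),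
        W.HasCM → W.analyticRank = 1 → IsImaginaryQuadratic K → SatisfiesHeegnerHypothesis N K →
        WeierstrassCurve.Affine.Point.map ι.toRatAlgHom P = heegnerPointComplex Dt H →
        (W.quadraticTwist (NumberField.discr K : ℚ)).entireLFunction 1 ≠ 0 →
        Cd • W.quadraticTwist (NumberField.discr K : ℚ) = Wd → (k = 1 ∨ k = 2) →
        (k = 2 ↔ ∀ y : W.toAffine.Point, ∃ Q : (W.baseChange K).toAffine.Point,
          QuadraticDescent.incl K W y - (2 : ℤ) • Q ∈ AddCommGroup.torsion (W.baseChange K).toAffine.Point) →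
        padicValRat 2 (cmHeegnerIndexQuotient W K P Dt.c k Wd Cd.u) ≤
          padicValNat 2 (Nat.card W.sha) :=
  lower_member_of_cert hsy_95071 hF (q := 16) padicValRat_two_16.le hq hS


end SylvesterTwoLowerCert

end Summit.BirchSwinnertonDyer.BirchSwinnertonDyer.Theorems

end
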